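import Summits.RiemannHypothesis.RiemannHypothesis.Theorems.WeilTwoPrimeDeflM80FBase
import Literature.NumberTheory.LFunctions.WeilBlockRowsFast
import HarnessLib

/-!
# Deflated two-prime certificate (weilCertDeflM80F): the Bessel block claim `Hp = C H Cᵀ` (parity 1), rows 115–119, fast check

`WeilCert.checkHpRowT` (linear traversals) instead of the indexed `checkHpRow` decide.  Pure proof file.
-/

set_option linter.dupNamespace false

noncomputable section

namespace Summit.RiemannHypothesis.RiemannHypothesis.Theorems.EvenWinsBeyondArch

open Literature.NumberTheory.LFunctions

set_option maxHeartbeats 0 in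
/-- Fast kernel check of claim row 115 of `Hp = C H Cᵀ` (parity 1; linear traversals, triangular `C`). [folklore] -/
theorem checkHpRowT1_115_weilCertDeflM80F : weilCertDeflM80FBase.checkHpRowT weilCertDeflM80FHpO 1 115 = true := by
  decide +kernel

/-- Claim row 115 of `Hp = C H Cᵀ` (parity 1), from the fast check. [folklore] -/
theorem checkHpRow1_115_weilCertDeflM80F : weilCertDeflM80FBase.checkHpRow weilCertDeflM80FHpO 1 115 = true :=
  WeilCert.checkHpRow_of_T checkHpRowT1_115_weilCertDeflM80F

set_option maxHeartbeats 0 in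
/-- Fast kernel check of claim row 116 of `Hp = C H Cᵀ` (parity 1; linear traversals, triangular `C`). [folklore] -/
theorem checkHpRowT1_116_weilCertDeflM80F : weilCertDeflM80FBase.checkHpRowT weilCertDeflM80FHpO 1 116 = true := by
  decide +kernel

/-- Claim row 116 of `Hp = C H Cᵀ` (parity 1), from the fast check. [folklore] -/
theorem checkHpRow1_116_weilCertDeflM80F : weilCertDeflM80FBase.checkHpRow weilCertDeflM80FHpO 1 116 = true :=
  WeilCert.checkHpRow_of_T checkHpRowT1_116_weilCertDeflM80F

set_option maxHeartbeats 0 in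
/-- Fast kernel check of claim row 117 of `Hp = C H Cᵀ` (parity 1; linear traversals, triangular `C`). [folklore] -/
theorem checkHpRowT1_117_weilCertDeflM80F : weilCertDeflM80FBase.checkHpRowT weilCertDeflM80FHpO 1 117 = true := by
  decide +kernel

/-- Claim row 117 of `Hp = C H Cᵀ` (parity 1), from the fast check. [folklore] -/
theorem checkHpRow1_117_weilCertDeflM80F : weilCertDeflM80FBase.checkHpRow weilCertDeflM80FHpO 1 117 = true :=
  WeilCert.checkHpRow_of_T checkHpRowT1_117_weilCertDeflM80F

set_option maxHeartbeats 0 in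
/-- Fast kernel check of claim row 118 of `Hp = C H Cᵀ` (parity 1; linear traversals, triangular `C`). [folklore] -/
theorem checkHpRowT1_118_weilCertDeflM80F : weilCertDeflM80FBase.checkHpRowT weilCertDeflM80FHpO 1 118 = true := by
  decide +kernel

/-- Claim row 118 of `Hp = C H Cᵀ` (parity 1), from the fast check. [folklore] -/
theorem checkHpRow1_118_weilCertDeflM80F : weilCertDeflM80FBase.checkHpRow weilCertDeflM80FHpO 1 118 = true :=
  WeilCert.checkHpRow_of_T checkHpRowT1_118_weilCertDeflM80F

set_option maxHeartbeats 0 in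
/-- Fast kernel check of claim row 119 of `Hp = C H Cᵀ` (parity 1; linear traversals, triangular `C`). [folklore] -/
theorem checkHpRowT1_119_weilCertDeflM80F : weilCertDeflM80FBase.checkHpRowT weilCertDeflM80FHpO 1 119 = true := by
  decide +kernel

/-- Claim row 119 of `Hp = C H Cᵀ` (parity 1), from the fast check. [folklore] -/
theorem checkHpRow1_119_weilCertDeflM80F : weilCertDeflM80FBase.checkHpRow weilCertDeflM80FHpO 1 119 = true :=
  WeilCert.checkHpRow_of_T checkHpRowT1_119_weilCertDeflM80F

end Summit.RiemannHypothesis.RiemannHypothesis.Theorems.EvenWinsBeyondArch
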